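import Literature.NumberTheory.EllipticCurves.TowerLocalH1CartesianProofs
import Literature.NumberTheory.EllipticCurves.ZpExtensionEisensteinTowerDivisionProofs
import Literature.NumberTheory.EllipticCurves.ZpExtensionScalarTwistFiniteProofs
import Literature.NumberTheory.GaloisRepresentations.LocalGlobalCohomologyFiniteProofs
import HarnessLib

/-!
# The saturated level conditions of `F_𝔮`'s local `p`-adic tower are cartesian along `×p^d` — end-to-end instance
# for the Eisenstein tower `M_k ⊗ A_{m,k}(ψ)` and for `E_K[p^k] ⊗ A_{m,k}(ψ)` (theorems only)

Topic `NumberTheory/EllipticCurves` (D1 road of cell `pub/bsd-print-x9`, Howard H.3 for `F_𝔮`).  No definition, no named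
fact, no instance, no `sorry`.

The turnkey `Tower.comap_map_levelCondition_eq_of_exact_nsmul` (`TowerLocalH1CartesianProofs`: Howard's H.3 for SATURATED
level conditions along the `Quot(T)`-morphisms `×p^d`, with the cohomological inputs (L)/(E)/(M)/(T) discharged) applied to
x9-p1-w3's two-index family `ZpExtension.eisensteinTwistTransfer` of the Eisenstein tower (`ZpExtensionEisensteinTowerDivisionProofs`:
`F a b : W_a → W_b`, the iterated reduction for `b ≤ a`, the division `×p^{b−a}` for `a ≤ b`, with `hid/hcomp/hsq/hinj/hsurj/
hex/hpow/hkill`), LOCALISED at a finite place `v` (`DiscreteGaloisModule.localMap _ (Sum.inr v)`; the one-step maps are D1's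
`ZpExtension.eisensteinLocalReduce` by `eisensteinTwistTransfer_succ_self`; `H¹(K_v, W_j)` is finite by
`finite_galoisCohomology_one_toLocal`):

* `ZpExtension.comap_levelCondition_eisensteinLocalReduce_eq` — for ANY cores `C_j ≤ H¹(K_v, W_j)` (in particular the
  ordinary / unramified cores of `F_𝔮 = ZpExtension.eisensteinSelmerStructure`) and all `i d`:
  `(levelCondition (eisensteinLocalReduce … v) p C (i+d)).comap H¹(F i (i+d))_v = levelCondition … p C i`;
* `WeierstrassCurve.comap_levelCondition_eisensteinLocalReduce_eq` — the curve `E_K[p^•]` (`W.eisensteinTwistTorsionTransfer`,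
  any lifts `t k` of `×p`), unconditionally.

This is Howard's hypothesis H.3 (arXiv:1202.6340 p. 7 L65–67, p. 16 L1–3) for `F_𝔮` along the `p`-power morphisms
between the `p`-adic levels; the general ideals `(π^i)` of `A_{m,k}` go through the `π`-adic refinement
(x10b-p1-w6's `PiRefinementDatum` + `Tower.comap_map_levelCondition_eq_of_exact_smul`).  Cell `pub/bsd-print-x9`;
seat `bsd-line-x10b-p1-w7` g0.  No summit statement is proved; BSD is not proved by any of this.

References: B. Howard, Compositio Math. 140 (2004), Def. 1.1.2–1.1.3, H.3, §2.2 (arXiv:1202.6340 p. 5 L88–99,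
p. 7 L65–67, p. 16 L1–3); B. Mazur, K. Rubin (2004), Lemma 3.7.1; J. Milne, *ADT* (2006), I Cor. 2.3.
-/

noncomputable section

open scoped TensorProduct ContRepresentation
open Function Field

namespace Literature.NumberTheory.EllipticCurves.ZpExtension

open Literature.NumberTheory.GaloisRepresentations IwasawaAlgebra
open scoped NumberField

variable {K : Type} [Field K] [NumberField K] {p : ℕ} [hp : Fact p.Prime] (κ : ZpExtension K p)
  {M : ℕ → Type} [∀ k, AddCommGroup (M k)] [∀ k, TopologicalSpace (M k)] [∀ k, DiscreteTopology (M k)]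
  [∀ k, Finite (M k)]
  (ρ : ∀ k, DiscreteGaloisModule K (M k))
  (t : ∀ k, (ρ (k + 1)).toContRepresentation →ⁱL (ρ k).toContRepresentation) {m : ℕ} (hm : 1 ≤ m)

/-- **H.3 for `F_𝔮` along `×p^d`, generic Eisenstein tower `W_k = M_k ⊗ A_{m,k}(ψ)`**: at a finite place `v`, for any
cores `C_j ≤ H¹(K_v, W_j)`, the saturated level conditions of the local tower `eisensteinLocalReduce … v` satisfy
`(L_{i+d}).comap H¹(×p^d)_v = L_i`.  Hypotheses: the tower data of `eisensteinTwistTransfer` (`ht`, `hkt`, `hkill`) and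
coordinates `M_k ≃ (ℤ/p^k)^{ι_k}` (for the injectivity of `×p^d`). [cite: Howard2004HeegnerKolyvagin, H.3 and Def. 1.1.2–1.1.3 (arXiv p. 5 L88–99, p. 16 L1–3)]
[cite: MazurRubinMemoirs2004, Lemma 3.7.1] -/
theorem comap_levelCondition_eisensteinLocalReduce_eq (ht : ∀ k, Function.Surjective (t k))
    (hkt : ∀ k (x : M (k + 1)), t k x = 0 ↔ ∃ y : M (k + 1), x = ((p : ℤ) ^ k) • y)
    (hkill : ∀ k (x : M k), ((p : ℤ) ^ k) • x = 0) {ι : ℕ → Type} [∀ k, Fintype (ι k)]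
    (e : ∀ k, M k ≃+ (ι k → ZMod (p ^ k))) (v : IsDedekindDomain.HeightOneSpectrum (𝓞 K))
    (C : ∀ j, AddSubgroup (galoisCohomology ((κ.eisensteinTwist (ρ j) hm j).toLocal (Sum.inr v)) 1)) (i d : ℕ) :
    (Tower.levelCondition (H := fun j ↦ galoisCohomology ((κ.eisensteinTwist (ρ j) hm j).toLocal (Sum.inr v)) 1)
        (κ.eisensteinLocalReduce ρ t hm (Sum.inr v)) p C (i + d)).comap
      (galoisCohomology.map (DiscreteGaloisModule.localMap
        (κ.eisensteinTwistTransfer ρ t hm ht hkt hkill i (i + d)) (Sum.inr v)) 1) =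
    Tower.levelCondition (H := fun j ↦ galoisCohomology ((κ.eisensteinTwist (ρ j) hm j).toLocal (Sum.inr v)) 1)
      (κ.eisensteinLocalReduce ρ t hm (Sum.inr v)) p C i := by
  have hfin : ∀ j, Finite (galoisCohomology
      (((κ.eisensteinTwist (ρ j) hm j : DiscreteGaloisModule K (EisensteinLevel p m M j))).toLocal (Sum.inr v)) 1) :=
    fun j ↦ by
      haveI : Finite (EisensteinCoeff.Twisted p m j (M j)) := EisensteinCoeff.finite_twisted hm
      haveI : Finite (EisensteinLevel p m M j) := EisensteinCoeff.finite_twisted hm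
      exact finite_galoisCohomology_one_toLocal _ v
  have hred : κ.eisensteinLocalReduce ρ t hm (Sum.inr v) = fun j ↦ galoisCohomology.map
      (DiscreteGaloisModule.localMap (κ.eisensteinTwistTransfer ρ t hm ht hkt hkill (j + 1) j) (Sum.inr v)) 1 := by
    funext j
    rw [κ.eisensteinTwistTransfer_succ_self ρ t hm ht hkt hkill j]
    rfl
  rw [hred]
  -- the levels are spelled through the type synonym `EisensteinLevel` so that their instances are synthesisable
  -- under the binder `j` (see `ZpExtensionEisensteinInvSystem`); everything is definitionally the `Twisted` spelling.
  exact @Tower.comap_map_levelCondition_eq_of_exact_nsmul _ _ (fun j ↦ EisensteinLevel p m M j) _ _ _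
    (fun j ↦ ((κ.eisensteinTwist (ρ j) hm j : DiscreteGaloisModule K (EisensteinLevel p m M j))).toLocal (Sum.inr v))
    (fun a b ↦ DiscreteGaloisModule.localMap (κ.eisensteinTwistTransfer ρ t hm ht hkt hkill a b) (Sum.inr v)) hfin
    (fun a w ↦ κ.eisensteinTwistTransfer_self ρ t hm ht hkt hkill a w)
    (fun a b c hcb hba w ↦ κ.eisensteinTwistTransfer_comp ρ t hm ht hkt hkill hcb hba w)
    (fun a b hab w ↦ κ.eisensteinTwistTransfer_sq ρ t hm ht hkt hkill hab w)
    (fun ℓ n ↦ κ.eisensteinTwistTransfer_injective_of_le ρ t hm ht hkt hkill e ℓ n)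
    (fun ℓ n ↦ κ.eisensteinTwistTransfer_surjective_of_le ρ t hm ht hkt hkill (Nat.le_add_left n ℓ))
    (fun ℓ n y ↦ κ.eisensteinTwistTransfer_eq_zero_iff_exists ρ t hm ht hkt hkill ℓ n y) p
    (fun ℓ n w ↦ κ.eisensteinTwistTransfer_apply_apply_of_le ρ t hm ht hkt hkill ℓ n w)
    (fun j w ↦ EisensteinCoeff.prime_pow_nsmul_twisted w) C i d

end Literature.NumberTheory.EllipticCurves.ZpExtension

namespace WeierstrassCurve

open Literature.NumberTheory.EllipticCurves Literature.NumberTheory.GaloisRepresentations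
open Literature.NumberTheory.EllipticCurves.IwasawaAlgebra
open scoped NumberField

variable {K : Type} [Field K] [NumberField K] (W : WeierstrassCurve K) [W.IsElliptic] {p : ℕ} [hp : Fact p.Prime]
  (κ : ZpExtension K p) {m : ℕ} (hm : 1 ≤ m)
  (t : ∀ k, (W.torsionGaloisModule ((p : ℤ) ^ (k + 1))).toContRepresentation →ⁱL
    (W.torsionGaloisModule ((p : ℤ) ^ k)).toContRepresentation)

/-- **H.3 for `F_𝔮` along `×p^d` for the curve's tower `E_K[p^k] ⊗ A_{m,k}(ψ)` — unconditional**: at every finite place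
`v` and for any cores `C_j ≤ H¹(K_v, E_K[p^j] ⊗ A_{m,j}(ψ))`, the saturated level conditions of D1's local tower
`eisensteinLocalReduce` are cartesian along the division maps `W.eisensteinTwistTorsionTransfer … i (i+d)`.
[cite: Howard2004HeegnerKolyvagin, H.3 and Def. 1.1.2–1.1.3 (arXiv p. 5 L88–99, p. 16 L1–3)] [cite: MazurRubinMemoirs2004, Lemma 3.7.1] -/
theorem comap_levelCondition_eisensteinLocalReduce_eq
    (ht : ∀ k (P : geomTorsion W ((p : ℤ) ^ (k + 1))),
      ((t k P : geomTorsion W ((p : ℤ) ^ k)) : geomPoints W) = (p : ℤ) • (P : geomPoints W))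
    (v : IsDedekindDomain.HeightOneSpectrum (𝓞 K))
    (C : ∀ j, AddSubgroup (galoisCohomology
      ((κ.eisensteinTwist (W.torsionGaloisModule ((p : ℤ) ^ j)) hm j).toLocal (Sum.inr v)) 1)) (i d : ℕ) :
    (Tower.levelCondition
        (H := fun j ↦ galoisCohomology ((κ.eisensteinTwist (W.torsionGaloisModule ((p : ℤ) ^ j)) hm j).toLocal
          (Sum.inr v)) 1)
        (κ.eisensteinLocalReduce (fun k ↦ W.torsionGaloisModule ((p : ℤ) ^ k)) t hm (Sum.inr v)) p C (i + d)).comap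
      (galoisCohomology.map (DiscreteGaloisModule.localMap
        (W.eisensteinTwistTorsionTransfer κ hm t ht i (i + d)) (Sum.inr v)) 1) =
    Tower.levelCondition
      (H := fun j ↦ galoisCohomology ((κ.eisensteinTwist (W.torsionGaloisModule ((p : ℤ) ^ j)) hm j).toLocal
        (Sum.inr v)) 1)
      (κ.eisensteinLocalReduce (fun k ↦ W.torsionGaloisModule ((p : ℤ) ^ k)) t hm (Sum.inr v)) p C i := by
  have hpK : (p : K) ≠ 0 := Nat.cast_ne_zero.2 hp.out.ne_zero
  haveI : ∀ k, Finite (geomTorsion W ((p : ℤ) ^ k)) := fun k ↦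
    finite_torsionPoints_holds W (AlgebraicClosure K) (pow_ne_zero _ (Int.natCast_ne_zero.mpr hp.out.ne_zero))
  exact κ.comap_levelCondition_eisensteinLocalReduce_eq (fun k ↦ W.torsionGaloisModule ((p : ℤ) ^ k)) t hm
    (W.torsionGaloisModule_transition_hypotheses t ht).1 (W.torsionGaloisModule_transition_hypotheses t ht).2.1
    (W.torsionGaloisModule_transition_hypotheses t ht).2.2
    (fun k ↦ (W.nonempty_geomTorsion_prime_pow_addEquiv_fin_two hpK k).some) v C i d

end WeierstrassCurve

end
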